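import Literature.NumberTheory.NumberFields.RayClassFieldLocalTowerCompositum
import Literature.NumberTheory.GaloisRepresentations.CompletionCompositumEmbeddingTower
import Literature.NumberTheory.GaloisRepresentations.CompletionCompositumUnitBall
import Literature.NumberTheory.GaloisRepresentations.LubinTateCharacterLimit
import HarnessLib

/-!
# `ψ_n : E·K_π^{n+1} ≅ K(𝔪v^{n+1})_{𝔓_n}` carries the relative NORMS of the Lubin–Tate tower to the LOCAL NORMS of the `𝔓`-tower, the `Γ_{K_v}`-action to the
# decomposition-group action, and the units / principal units of the spectral norm to `𝒪^×_{𝔓_n}` / `U¹_{𝔓_n}` (de Shalit II.1.10, III.1.1–1.2 at the split prime)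

Sequel of `RayClassFieldLocalTowerCompositum` (★★★ `compositum_rayClassField_mul_pow_eq : K_v·ι(K(𝔪v^{n+1})) = E ⊔ ltField π n`, ★★ `supLtFieldEquivAdicCompletion`
= `ψ_n`), using `GaloisRepresentations/CompletionCompositumEmbeddingTower` (the distinguished places of a tower cohere; `compositumEquivEmb` intertwines relative
norms, inclusions and the `Γ_{K_v}`-action) and `GaloisRepresentations/CompletionCompositumUnitBall` (unit balls / units / principal units under any
`K_v(E) ≅ E_w`).  For two levels `(𝔪, α, E, n)` and `(𝔪', α', E', n')` of the ray class / Lubin–Tate towers with `K(𝔪v^{n+1}) ≤ K(𝔪'v^{n'+1})` and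
`E·K_π^{n+1} ≤ E'·K_π^{n'+1}` (both the `v`-direction `n ≤ n'` and de Shalit's UNRAMIFIED direction `𝔪' = 𝔪v̄`, `E ≤ E'` are instances):

* §1 `norm_equivOfEq` — re-typing along an equality of subfields of `K̄_v` is an isometry of the spectral norms; `towerNorm_equivOfEq` — and commutes with
  relative norms.
* §2 ★★★ **`supLtFieldEquivAdicCompletion_towerNorm`** — `ψ (N_{E'K_π^{n'+1}/EK_π^{n+1}} y) = N_{K(𝔪'v^{n'+1})_{𝔓'}/K(𝔪v^{n+1})_{𝔓}} (ψ' y)`: the coherence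
  condition of the tree's `RelNormCoherentUnits` (`coherent`, `v`-direction) and of `baseNorm`/`principalCoherentFamilies` (unramified direction) IS the
  norm-coherence of Rubin's `U_∞ = lim← U(F)` at the prime `𝔓` (`SemilocalUnitTowerCoinvOrbitsNorm`: the transition on the orbit factor is the local norm).
* §3 ★★ `supLtFieldEquivAdicCompletion_smul` — `ψ_n(d • y) = (res d|_{K(𝔪v^{n+1})})_{𝔓_n} (ψ_n y)` for every `d ∈ Γ_{K_v}`: the action `RelNormCoherentUnits.galAct`
  of the Lubin–Tate files is the decomposition-group action on the completion.
* §4 ★★ units and principal units: `norm_eq_one_iff_valued_supLtFieldEquiv_eq_one` (`‖y‖ = 1 ⟺ v_{𝔓_n}(ψ_n y) = 1`),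
  `norm_sub_one_lt_one_iff_valued_supLtFieldEquiv_sub_one_lt_one` (`‖y − 1‖ < 1 ⟺ v_{𝔓_n}(ψ_n y − 1) < 1`), `norm_le_one_iff_…` — the conditions
  `norm_eq_one` / `‖β₀ − 1‖ < 1` of `RelNormCoherentUnits` / `principalCoherentFamilies` versus `𝒪^×_{𝔓_n}` / `U¹_{𝔓_n}` (`ValuationSubring.unitGroup` /
  `principalUnitGroup`, Rubin's place model).

Cell `bsd-print-cf2`, brick §4(c)/(e), dictionary item D2 «local model» LM3 (memo BRICK-C-ORBITS-g22 §3).  Theorems only; no definition, no named fact, no instance,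
no `sorry`; the normed structures are the Lubin–Tate files' LOCAL instances.

## References
* [deShalit1987] E. de Shalit, *Iwasawa theory of elliptic curves with complex multiplication* (1987), II.1.10 (p. 39), II.4.5 (12)–(13) (p. 58), III.1.1–1.2 (p. 88–89, 101).
* [CasselsFrohlichANT1967] Cassels–Fröhlich (1967), Ch. II §10–§11, Ch. VII §1.1.
* [SerreLocalFields1979] J.-P. Serre, *Local Fields* (1979), Ch. II §2 Cor. 3–4.
-/

noncomputable section

open NumberField IsDedekindDomain IsDedekindDomain.HeightOneSpectrum Field
open scoped nonZeroDivisors Classical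

namespace Literature.NumberTheory.NumberFields

open Literature.NumberTheory.GaloisRepresentations
open Literature.NumberTheory.GaloisRepresentations.ArtinLocalGlobal
open Literature.NumberTheory.GaloisRepresentations.IsNonarchimedeanLocalField
open Literature.NumberTheory.GaloisRepresentations.LubinTate
open Literature.NumberTheory.Automorphic
open ValuativeRel

attribute [local instance] ltNormUniformSpace ltNormIsUniformAddGroup rk1 nF nE fintypeResidueField

/-! ### §1. Re-typing along an equality of subfields: isometry, relative norms -/

section EquivOfEq

variable {F : Type} [Field F] [ValuativeRel F] [TopologicalSpace F] [IsNonarchimedeanLocalField F]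
  {M₁ M₂ C₁ C₂ : IntermediateField F (AlgebraicClosure F)} [FiniteDimensional F M₁] [FiniteDimensional F C₁]

/-- Re-typing along an equality `M₁ = C₁` of finite subextensions of `F̄` is an isometry of the spectral norms (the spectral norm of `x` only depends on its minimal
polynomial over `F`). [cite: SerreLocalFields1979, Ch. II §2 Cor. 3] -/
theorem norm_equivOfEq (h : M₁ = C₁) (y : M₁) : ‖IntermediateField.equivOfEq h y‖ = ‖y‖ := by
  rw [norm_eq_spectralNorm, norm_eq_spectralNorm, spectralNorm, spectralNorm, minpoly.algEquiv_eq]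

omit [ValuativeRel F] [TopologicalSpace F] [IsNonarchimedeanLocalField F] [FiniteDimensional F M₁] [FiniteDimensional F C₁] in
/-- Re-typing along equalities `M₁ = C₁`, `M₂ = C₂` with `M₁ ≤ M₂` commutes with the relative norms of the tower algebras (Mathlib `Algebra.norm_eq_of_equiv_equiv`; the
structure maps are inclusions on both sides). [cite: CasselsFrohlichANT1967, Ch. II §11] -/
theorem towerNorm_equivOfEq (h₁ : M₁ = C₁) (h₂ : M₂ = C₂) (hM : M₁ ≤ M₂) (hC : C₁ ≤ C₂) (y : M₂) :
    IntermediateField.equivOfEq h₁ (@Algebra.norm M₁ M₂ _ _ (towerAlgebra hM) y) =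
      @Algebra.norm C₁ C₂ _ _ (towerAlgebra hC) (IntermediateField.equivOfEq h₂ y) := by
  letI := towerAlgebra hM
  letI := towerAlgebra hC
  have he : RingHom.comp (algebraMap C₁ C₂) ((IntermediateField.equivOfEq h₁).toRingEquiv : M₁ →+* C₁) =
      RingHom.comp ((IntermediateField.equivOfEq h₂).toRingEquiv : M₂ →+* C₂) (algebraMap M₁ M₂) := by
    refine RingHom.ext fun x ↦ Subtype.ext ?_
    rfl
  rw [Algebra.norm_eq_of_equiv_equiv (IntermediateField.equivOfEq h₁).toRingEquiv (IntermediateField.equivOfEq h₂).toRingEquiv he y]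
  exact (IntermediateField.equivOfEq h₁).toRingEquiv.apply_symm_apply _

end EquivOfEq

/-! ### §2. `ψ` carries relative norms to local norms -/

variable {K : Type} [Field K] [NumberField K] [IsTotallyComplex K] {v : HeightOneSpectrum (𝓞 K)}
  {π : 𝒪[v.adicCompletion K]} (hπ : (valuation (v.adicCompletion K)).IsUniformizer (π : v.adicCompletion K))
  -- level data `(𝔪, α, f, E)`
  {𝔪 : Ideal (𝓞 K)} (h𝔪 : 𝔪 ≠ ⊥) (hv : ¬ 𝔪 ≤ v.asIdeal) (hw : ∀ u : (𝓞 K)ˣ, (u : 𝓞 K) - 1 ∈ 𝔪 → u = 1)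
  {α : 𝓞 K} (hα0 : α ≠ 0) (hα𝔪 : α - 1 ∈ 𝔪) (hαw : ∀ w : HeightOneSpectrum (𝓞 K), w ≠ v → α ∉ w.asIdeal)
  {f : ℕ} (hαπ : ((α : K) : v.adicCompletion K) = (π : v.adicCompletion K) ^ f)
  (E : IntermediateField (v.adicCompletion K) (AlgebraicClosure (v.adicCompletion K)))
  [FiniteDimensional (v.adicCompletion K) E] [Normal (v.adicCompletion K) E] (hE : E ≤ maxUnramified (v.adicCompletion K))
  (hdegE : ∀ w : WeilGroup (v.adicCompletion K),
    WeilGroup.toAbsGalois (v.adicCompletion K) w ∈ E.fixingSubgroup → (f : ℤ) ∣ WeilGroup.deg w)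
  (hdvd : ((Module.finrank (v.adicCompletion K) E : ℕ) : ℤ) ∣
    (orderOf (abRestrict (rayClassField K 𝔪)
      (ideleArtinMap K (localUnits v (Units.mk0 (π : v.adicCompletion K) hπ.ne_zero)))) : ℤ))
  -- level data `(𝔪', α', f', E')`
  {𝔪' : Ideal (𝓞 K)} (h𝔪' : 𝔪' ≠ ⊥) (hv' : ¬ 𝔪' ≤ v.asIdeal) (hw' : ∀ u : (𝓞 K)ˣ, (u : 𝓞 K) - 1 ∈ 𝔪' → u = 1)
  {α' : 𝓞 K} (hα'0 : α' ≠ 0) (hα'𝔪 : α' - 1 ∈ 𝔪') (hα'w : ∀ w : HeightOneSpectrum (𝓞 K), w ≠ v → α' ∉ w.asIdeal)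
  {f' : ℕ} (hα'π : ((α' : K) : v.adicCompletion K) = (π : v.adicCompletion K) ^ f')
  (E' : IntermediateField (v.adicCompletion K) (AlgebraicClosure (v.adicCompletion K)))
  [FiniteDimensional (v.adicCompletion K) E'] [Normal (v.adicCompletion K) E'] (hE' : E' ≤ maxUnramified (v.adicCompletion K))
  (hdegE' : ∀ w : WeilGroup (v.adicCompletion K),
    WeilGroup.toAbsGalois (v.adicCompletion K) w ∈ E'.fixingSubgroup → (f' : ℤ) ∣ WeilGroup.deg w)
  (hdvd' : ((Module.finrank (v.adicCompletion K) E' : ℕ) : ℤ) ∣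
    (orderOf (abRestrict (rayClassField K 𝔪')
      (ideleArtinMap K (localUnits v (Units.mk0 (π : v.adicCompletion K) hπ.ne_zero)))) : ℤ))

/-- ★★★ **`ψ (N_{E'K_π^{n'+1}/EK_π^{n+1}} y) = N_{K(𝔪'v^{n'+1})_{𝔓'}/K(𝔪v^{n+1})_{𝔓}} (ψ' y)`** — for two levels with `K(𝔪v^{n+1}) ≤ K(𝔪'v^{n'+1})` (`hL`) and
`E·K_π^{n+1} ≤ E'·K_π^{n'+1}` (`hM`), the isomorphisms `ψ = supLtFieldEquivAdicCompletion` carry the relative norm of the Lubin–Tate tower (`towerAlgebra hM`) to the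
LOCAL NORM of the completions at the distinguished primes (`algebraPlace` of `𝔓' ∣ 𝔓`, `SemiLocal.embPlaceOver`).  Instances: the `v`-direction `𝔪' = 𝔪`, `E' = E`,
`n ≤ n'` (the `coherent` field of `RelNormCoherentUnits`) and the unramified direction `𝔪' ≤ 𝔪`, `E ≤ E'`, `n' = n` (`RelNormCoherentUnits.baseNorm`).
[cite: deShalit1987, II.1.10 (p. 39), III.1.1–1.2 (2) (p. 88–89, 101)] [cite: CasselsFrohlichANT1967, Ch. II §11] -/
theorem supLtFieldEquivAdicCompletion_towerNorm (n n' : ℕ)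
    (hL : rayClassField K (𝔪 * v.asIdeal ^ (n + 1)) ≤ rayClassField K (𝔪' * v.asIdeal ^ (n' + 1)))
    (hM : (E ⊔ ltField π n : IntermediateField (v.adicCompletion K) (AlgebraicClosure (v.adicCompletion K))) ≤ E' ⊔ ltField π n')
    (y : (E' ⊔ ltField π n' : IntermediateField (v.adicCompletion K) (AlgebraicClosure (v.adicCompletion K)))) :
    letI := towerAlgebra hL
    supLtFieldEquivAdicCompletion h𝔪 hv hw hπ hα0 hα𝔪 hαw hαπ E hE hdegE hdvd n
        (@Algebra.norm (E ⊔ ltField π n : IntermediateField (v.adicCompletion K) (AlgebraicClosure (v.adicCompletion K)))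
          (E' ⊔ ltField π n' : IntermediateField (v.adicCompletion K) (AlgebraicClosure (v.adicCompletion K))) _ _ (towerAlgebra hM) y) =
      @Algebra.norm
        (((SemiLocal.embPlace v (rayClassField K (𝔪 * v.asIdeal ^ (n + 1))).val :
            SemiLocal.Place K (rayClassField K (𝔪 * v.asIdeal ^ (n + 1))) v) :
            HeightOneSpectrum (𝓞 (rayClassField K (𝔪 * v.asIdeal ^ (n + 1))))).adicCompletion (rayClassField K (𝔪 * v.asIdeal ^ (n + 1))))
        (((SemiLocal.embPlace v (rayClassField K (𝔪' * v.asIdeal ^ (n' + 1))).val :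
            SemiLocal.Place K (rayClassField K (𝔪' * v.asIdeal ^ (n' + 1))) v) :
            HeightOneSpectrum (𝓞 (rayClassField K (𝔪' * v.asIdeal ^ (n' + 1))))).adicCompletion (rayClassField K (𝔪' * v.asIdeal ^ (n' + 1))))
        _ _ (SemiLocal.algebraPlace (SemiLocal.embPlaceOver v (rayClassField K (𝔪 * v.asIdeal ^ (n + 1)))
          (rayClassField K (𝔪' * v.asIdeal ^ (n' + 1))) hL))
        (supLtFieldEquivAdicCompletion h𝔪' hv' hw' hπ hα'0 hα'𝔪 hα'w hα'π E' hE' hdegE' hdvd' n' y) := by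
  letI := towerAlgebra hL
  rw [supLtFieldEquivAdicCompletion_apply, supLtFieldEquivAdicCompletion_apply,
    towerNorm_equivOfEq (compositum_rayClassField_mul_pow_eq h𝔪 hv hw hπ hα0 hα𝔪 hαw hαπ E hE hdegE hdvd n).symm
      (compositum_rayClassField_mul_pow_eq h𝔪' hv' hw' hπ hα'0 hα'𝔪 hα'w hα'π E' hE' hdegE' hdvd' n').symm hM
      (SemiLocal.adjoin_range_le_of_tower v (rayClassField K (𝔪 * v.asIdeal ^ (n + 1))).val (rayClassField K (𝔪' * v.asIdeal ^ (n' + 1))).val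
        (SemiLocal.val_towerAlgebra_algebraMap (rayClassField K (𝔪 * v.asIdeal ^ (n + 1))) (rayClassField K (𝔪' * v.asIdeal ^ (n' + 1))) hL))]
  exact SemiLocal.compositumEquivEmb_towerNorm v (rayClassField K (𝔪 * v.asIdeal ^ (n + 1))) (rayClassField K (𝔪' * v.asIdeal ^ (n' + 1))) hL _

/-! ### §3. `ψ_n` is `Γ_{K_v}`-equivariant -/

include hπ in
omit [IsTotallyComplex K] [FiniteDimensional (v.adicCompletion K) E] in
/-- `E·K_π^{n+1}` is stable under `Γ_{K_v}` (`E`, `K_π^{n+1}` normal). [cite: CasselsFrohlichANT1967, Ch. VI §3.6 Prop. 6] -/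
theorem smul_mem_sup_ltField (n : ℕ) (d : absoluteGaloisGroup (v.adicCompletion K))
    {y : AlgebraicClosure (v.adicCompletion K)}
    (hy : y ∈ (E ⊔ ltField π n : IntermediateField (v.adicCompletion K) (AlgebraicClosure (v.adicCompletion K)))) :
    d • y ∈ (E ⊔ ltField π n : IntermediateField (v.adicCompletion K) (AlgebraicClosure (v.adicCompletion K))) := by
  haveI := isGalois_ltField hπ n
  exact IntermediateField.normal_iff_forall_map_le'.mp inferInstance (absoluteGaloisGroup.toAlgEquiv (v.adicCompletion K) d) ⟨y, hy, rfl⟩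

/-- ★★ **`ψ_n(d • y) = (res d|_{K(𝔪v^{n+1})})_{𝔓_n} (ψ_n y)` for every `d ∈ Γ_{K_v}`**: the action of `Γ_{K_v}` on `E·K_π^{n+1}` (the Lubin–Tate files'
`galAct`) is, through `ψ_n`, the action of the decomposition group of `𝔓_n` in `Gal(K(𝔪v^{n+1})/K)` on the completion (`galAdicCompletionMap`; the restriction
`res d|_{K(𝔪v^{n+1})}` fixes `𝔓_n`, `SemiLocal.absRestrictNormalHom_absGaloisRestrict_smul_coe_embPlace`). [cite: CasselsFrohlichANT1967, Ch. VII §1.1]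
[cite: deShalit1987, II.4.5 (13) (p. 58)] -/
theorem supLtFieldEquivAdicCompletion_smul (n : ℕ) (d : absoluteGaloisGroup (v.adicCompletion K))
    (y : (E ⊔ ltField π n : IntermediateField (v.adicCompletion K) (AlgebraicClosure (v.adicCompletion K)))) :
    supLtFieldEquivAdicCompletion h𝔪 hv hw hπ hα0 hα𝔪 hαw hαπ E hE hdegE hdvd n
        ⟨d • (y : AlgebraicClosure (v.adicCompletion K)), smul_mem_sup_ltField hπ E n d y.2⟩ =
      galAdicCompletionMap
        (absRestrictNormalHom (rayClassField K (𝔪 * v.asIdeal ^ (n + 1))) (absGaloisRestrict K (v.adicCompletion K) d))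
        (SemiLocal.absRestrictNormalHom_absGaloisRestrict_smul_coe_embPlace v (rayClassField K (𝔪 * v.asIdeal ^ (n + 1))) d)
        (supLtFieldEquivAdicCompletion h𝔪 hv hw hπ hα0 hα𝔪 hαw hαπ E hE hdegE hdvd n y) := by
  rw [supLtFieldEquivAdicCompletion_apply, supLtFieldEquivAdicCompletion_apply,
    ← SemiLocal.compositumEquivEmb_smul_absRestrictNormalHom v (rayClassField K (𝔪 * v.asIdeal ^ (n + 1))) d]
  refine congrArg _ (Subtype.ext ?_)
  rw [coe_equivOfEq_compositum_apply h𝔪 hv hw hπ hα0 hα𝔪 hαw hαπ E hE hdegE hdvd n]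
  exact congrArg (fun z : AlgebraicClosure (v.adicCompletion K) ↦ d • z)
    (coe_equivOfEq_compositum_apply h𝔪 hv hw hπ hα0 hα𝔪 hαw hαπ E hE hdegE hdvd n y).symm

/-! ### §4. Units and principal units -/

/-- `‖y‖ ≤ 1 ⟺ v_{𝔓_n}(ψ_n y) ≤ 1`: the unit ball of `E·K_π^{n+1}` is carried onto `𝒪_{𝔓_n}`. [cite: SerreLocalFields1979, Ch. II §2 Cor. 4] -/
theorem norm_le_one_iff_valued_supLtFieldEquiv_le_one (n : ℕ)
    (y : (E ⊔ ltField π n : IntermediateField (v.adicCompletion K) (AlgebraicClosure (v.adicCompletion K)))) :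
    ‖y‖ ≤ 1 ↔ Valued.v (supLtFieldEquivAdicCompletion h𝔪 hv hw hπ hα0 hα𝔪 hαw hαπ E hE hdegE hdvd n y) ≤ 1 := by
  haveI := SemiLocal.finiteDimensional_compositum_of_place (rayClassField K (𝔪 * v.asIdeal ^ (n + 1))).val
    (SemiLocal.embPlace v (rayClassField K (𝔪 * v.asIdeal ^ (n + 1))).val)
  rw [supLtFieldEquivAdicCompletion_apply, ← norm_equivOfEq (compositum_rayClassField_mul_pow_eq h𝔪 hv hw hπ hα0 hα𝔪 hαw hαπ E hE hdegE hdvd n).symm y]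
  exact SemiLocal.spectralNorm_le_one_iff_valued_le_one _ (SemiLocal.compositumEquivEmb v _) _

/-- ★★ **`‖y‖ = 1 ⟺ v_{𝔓_n}(ψ_n y) = 1`** — the units of `𝒪_{E·K_π^{n+1}}` (the `norm_eq_one` condition of `RelNormCoherentUnits`) are carried onto `𝒪^×_{𝔓_n}`.
[cite: SerreLocalFields1979, Ch. II §2 Cor. 4] -/
theorem norm_eq_one_iff_valued_supLtFieldEquiv_eq_one (n : ℕ)
    (y : (E ⊔ ltField π n : IntermediateField (v.adicCompletion K) (AlgebraicClosure (v.adicCompletion K)))) :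
    ‖y‖ = 1 ↔ Valued.v (supLtFieldEquivAdicCompletion h𝔪 hv hw hπ hα0 hα𝔪 hαw hαπ E hE hdegE hdvd n y) = 1 := by
  haveI := SemiLocal.finiteDimensional_compositum_of_place (rayClassField K (𝔪 * v.asIdeal ^ (n + 1))).val
    (SemiLocal.embPlace v (rayClassField K (𝔪 * v.asIdeal ^ (n + 1))).val)
  rw [supLtFieldEquivAdicCompletion_apply, ← norm_equivOfEq (compositum_rayClassField_mul_pow_eq h𝔪 hv hw hπ hα0 hα𝔪 hαw hαπ E hE hdegE hdvd n).symm y]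
  exact SemiLocal.spectralNorm_eq_one_iff_valued_eq_one _ (SemiLocal.compositumEquivEmb v _) _

/-- ★★ **`‖y − 1‖ < 1 ⟺ v_{𝔓_n}(ψ_n y − 1) < 1`** — the principal units of `E·K_π^{n+1}` (the condition of `principalCoherentFamilies`) are carried onto `U¹_{𝔓_n}`
(`SemiLocal.mem_principalUnitGroup_adicCompletionIntegers_iff`). [cite: SerreLocalFields1979, Ch. II §2 Cor. 4] -/
theorem norm_sub_one_lt_one_iff_valued_supLtFieldEquiv_sub_one_lt_one (n : ℕ)
    (y : (E ⊔ ltField π n : IntermediateField (v.adicCompletion K) (AlgebraicClosure (v.adicCompletion K)))) :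
    ‖y - 1‖ < 1 ↔ Valued.v (supLtFieldEquivAdicCompletion h𝔪 hv hw hπ hα0 hα𝔪 hαw hαπ E hE hdegE hdvd n y - 1) < 1 := by
  haveI := SemiLocal.finiteDimensional_compositum_of_place (rayClassField K (𝔪 * v.asIdeal ^ (n + 1))).val
    (SemiLocal.embPlace v (rayClassField K (𝔪 * v.asIdeal ^ (n + 1))).val)
  rw [supLtFieldEquivAdicCompletion_apply, ← norm_equivOfEq (compositum_rayClassField_mul_pow_eq h𝔪 hv hw hπ hα0 hα𝔪 hαw hαπ E hE hdegE hdvd n).symm (y - 1),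
    map_sub, map_one]
  exact SemiLocal.spectralNorm_sub_one_lt_one_iff _ (SemiLocal.compositumEquivEmb v _) _

/-- `‖y‖ < 1 ⟺ v_{𝔓_n}(ψ_n y) < 1` (maximal ideals). [cite: SerreLocalFields1979, Ch. II §2 Cor. 4] -/
theorem norm_lt_one_iff_valued_supLtFieldEquiv_lt_one (n : ℕ)
    (y : (E ⊔ ltField π n : IntermediateField (v.adicCompletion K) (AlgebraicClosure (v.adicCompletion K)))) :
    ‖y‖ < 1 ↔ Valued.v (supLtFieldEquivAdicCompletion h𝔪 hv hw hπ hα0 hα𝔪 hαw hαπ E hE hdegE hdvd n y) < 1 := by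
  haveI := SemiLocal.finiteDimensional_compositum_of_place (rayClassField K (𝔪 * v.asIdeal ^ (n + 1))).val
    (SemiLocal.embPlace v (rayClassField K (𝔪 * v.asIdeal ^ (n + 1))).val)
  rw [supLtFieldEquivAdicCompletion_apply, ← norm_equivOfEq (compositum_rayClassField_mul_pow_eq h𝔪 hv hw hπ hα0 hα𝔪 hαw hαπ E hE hdegE hdvd n).symm y]
  exact SemiLocal.spectralNorm_lt_one_iff_valued_lt_one _ (SemiLocal.compositumEquivEmb v _) _

/-- **Units as group elements**: a unit `u` of `K(𝔪v^{n+1})_{𝔓_n}` lies in `U¹_{𝔓_n}` (`ValuationSubring.principalUnitGroup`) iff `‖ψ_n⁻¹ u − 1‖ < 1`.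
[cite: SerreLocalFields1979, Ch. II §2 Cor. 4] -/
theorem mem_principalUnitGroup_iff_norm_supLtFieldEquiv_symm_sub_one_lt_one (n : ℕ)
    (u : (((SemiLocal.embPlace v (rayClassField K (𝔪 * v.asIdeal ^ (n + 1))).val :
        SemiLocal.Place K (rayClassField K (𝔪 * v.asIdeal ^ (n + 1))) v) :
        HeightOneSpectrum (𝓞 (rayClassField K (𝔪 * v.asIdeal ^ (n + 1))))).adicCompletion (rayClassField K (𝔪 * v.asIdeal ^ (n + 1))))ˣ) :
    u ∈ (((SemiLocal.embPlace v (rayClassField K (𝔪 * v.asIdeal ^ (n + 1))).val :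
        SemiLocal.Place K (rayClassField K (𝔪 * v.asIdeal ^ (n + 1))) v) :
        HeightOneSpectrum (𝓞 (rayClassField K (𝔪 * v.asIdeal ^ (n + 1))))).adicCompletionIntegers
          (rayClassField K (𝔪 * v.asIdeal ^ (n + 1)))).principalUnitGroup ↔
      ‖((supLtFieldEquivAdicCompletion h𝔪 hv hw hπ hα0 hα𝔪 hαw hαπ E hE hdegE hdvd n).symm u :
          (E ⊔ ltField π n : IntermediateField (v.adicCompletion K) (AlgebraicClosure (v.adicCompletion K)))) - 1‖ < 1 := by
  rw [norm_sub_one_lt_one_iff_valued_supLtFieldEquiv_sub_one_lt_one hπ h𝔪 hv hw hα0 hα𝔪 hαw hαπ E hE hdegE hdvd n, AlgEquiv.apply_symm_apply]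
  exact SemiLocal.mem_principalUnitGroup_adicCompletionIntegers_iff _ u

end Literature.NumberTheory.NumberFields

end
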